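import Summits.HodgeConjecture.HodgeConjecture.Theorems.F0P6aImgSectionRowAssembled
import HarnessLib

/-!
# `F0P6aImgSection` — ★ RE-HOME of `Lines/F0_P6a_ImgSection.lean` (tree sha16 bfb84779d70f88f8, 943 l.), PART 4 of 4 — tree lines :890–:943 (LAST part: plain stem = the module the `Lines/` shim and every consumer import)
See PART 1 `Theorems/F0P6aImgSectionKill.lean` for the full ★ re-home header and the original module docstring (verbatim there).  Same namespace (every
fully-qualified name unchanged); the scopes open at the cut are re-opened below with their `variable` ∕ `open` ∕ `set_option` ∕ `universe` lines replayed verbatim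
from the tree, in order; the code after the replay block is the tree bytes :890–:943, untouched.  HC_CM is proved only modulo the 7 printed citations (2 remaining: hLiu418 = stmt-HodgeConjecture-24832, h413 = stmt-HodgeConjecture-24833) until rung 0 closes; a re-home is count-neutral.
-/

-- ── replay of the scopes open at tree line :890 (verbatim) ──
set_option autoImplicit false
set_option linter.dupNamespace false
noncomputable section
namespace Summit.HodgeConjecture.HodgeConjecture.Cruxes.HLiu418.F0P6aLineSpecialisation
open CategoryTheory CategoryTheory.Limits NumberField IsDedekindDomain MulAction AlgebraicGeometry
open scoped Matrix Polynomial Pointwise MonoidalCategory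
open Literature.NumberTheory.GaloisRepresentations
open Literature.NumberTheory.Automorphic Literature.NumberTheory.Automorphic.UnitaryGroup
open Literature.AlgebraicGeometry.ShimuraVarieties.UnitaryCanonicalModel
open Literature.NumberTheory.Automorphic.Liu2021.AppendixC
open Literature.AlgebraicGeometry.Motives (AlgPoints IntegralModel SchemeOver thickening thickeningGalAction thickeningLift specOver extendPoint
  specValuationSubring specFractionFieldι specRingHomι)
open Literature.NumberTheory.DiophantineGeometry (geomResidueField specialFibreFunctor specResidueField geomClosedPointIsoSpecResidueField
  geomResidueFieldEquiv toClosureValuationSubring)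
open Literature.AlgebraicGeometry.RelativeSpec (ActionOver)
open Literature.NumberTheory.EllipticCurves (genericFibre specGenericPoint)
open Literature.AlgebraicGeometry.AbelianSchemes Literature.AlgebraicGeometry.AbelianSchemes.AbelianSchemeOver
open Literature.AlgebraicGeometry.GroupSchemes.AffineGroupScheme (Alg)
open Summit.HodgeConjecture.HodgeConjecture.Cruxes.HLiu418.F0P6aModuliDatumDefs
open Summit.HodgeConjecture.HodgeConjecture.Cruxes.HLiu418.F0P6aRGDAssembly
open Summit.HodgeConjecture.HodgeConjecture.Cruxes.HLiu418.F0P6aDatumOfInputs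
section ImgRowAssembled
set_option synthInstance.maxHeartbeats 100000
open Literature.AlgebraicGeometry.GroupSchemes (GroupSchemeKernel.ker GroupSchemeKernel.kerι)
open Literature.AlgebraicGeometry.GroupSchemes.AffineGroupScheme (quotIncl ptEquiv algBaseChangeEquiv)
variable {F : Type} [Field F] [NumberField F] [IsCMField F] {ι₁ : F →+* ℂ}
    {Jstar : Matrix (Fin 2) (Fin 2) F}
    {K₀ : C5.OpenCompactSubgroup ↥(finAdelic ↥(maximalRealSubfield F) F (IsCMField.complexConj F) 2 Jstar)}
    {S : RecordSystemGS F Jstar ι₁ K₀} {hU7ₛ : S.HeckeTranslateDefinedOver}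
    {hJ : (Jstar.map (IsCMField.complexConj F))ᵀ = Jstar} {hJu : IsUnit Jstar}
    {Fi : Type} [Field Fi] [Algebra F Fi] {Kc : C5.SmallLevel K₀} {G : Type} [Group G]
    {𝓜 : IntegralModel (𝓞 F) F ((thickening F Fi).obj (S.M.obj Kc))}
    {w : HeightOneSpectrum (𝓞 F)} {hw : (IsCMField.complexConj F) • w ≠ w} {h𝓨 : (𝓜.localise w).IsSmoothProper 1}
    {θ : ActionOver (𝓜.localise w).total.hom ((Fi ≃ₐ[F] Fi) × G)}
    {e : Fi →ₐ[F] AlgebraicClosure (w.adicCompletion F)}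
variable (I : RGDInputsAt F ι₁ Jstar K₀ S hU7ₛ hJ hJu Fi Kc G 𝓜 w hw h𝓨 θ e)

set_option maxHeartbeats 400000 in
open scoped MonObj CategoryTheory.Obj in
set_option backward.isDefEq.respectTransparency false in
/-- **`row_IMG` — the (IMG) conjunct of `exists_quotLegReduction_of_legs`, (F1) DISCHARGED (LS ED. 3)**: from § J's output «there is a line `Lb` at `y″` with the image-line
membership law AND the clause `ρ Lb`» (B-p08 `imgLine_quotΩ_quotΩ_eq_translΩ_assembled`: `ρ Lb := (quotΩ (quotΩ y L) Lb = translΩ y)`, membership = `mem_imgLineOfRoof_iff`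
= `Iff.rfl`) and the inputs of `himg_spGeoOf_of_roofRows_of_sigma`, the row `∃ Lb, ρ Lb ∧ himg(Lb)` with the dock instances spelled as in the socket.
[cite: Liu2021, Prop. D.8 (1)(2) p. 135, p. 137] -/
theorem row_IMG [ExpChar (geomResidueField w) I.pChar] (𝔡 : ∀ xbar, DockAt I xbar)
    (y y'' : AlgPoints (S.M.obj Kc) (AlgebraicClosure (w.adicCompletion F))) (ρ : LineOf I y'' → Prop)
    {B : AbelianSchemeOver (Spec (.of (AlgebraicClosure (w.adicCompletion F))))}
    (q : (schΩOf S Kc 𝓜 w e I.univ y).X ⟶ B.X) [IsMonHom q] (c : (schΩOf S Kc 𝓜 w e I.univ y'').X ⟶ B.X) [IsMonHom c]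
    {M : SchemeOver (geomResidueField w)}
    (ψ : (sch₀Of 𝓜 w I.univ (red₀Of S Kc 𝓜 w h𝓨 e y)).X ⟶ M) (cbar : (sch₀Of 𝓜 w I.univ (red₀Of S Kc 𝓜 w h𝓨 e y'')).X ⟶ M)
    {m : ℕ} (E' : Matrix (Fin m) (Fin m) (𝓞 F)) (hE' : E' * E' = E') (P : Matrix (Fin m) (Fin 1) (𝓞 F)) (Q : Matrix (Fin 1) (Fin m) (𝓞 F))
    (hP : E' * P = P) (hQ : Q * E' = Q) (hQP : Q * P = Matrix.scalar (Fin 1) (I.pChar : 𝓞 F))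
    (hPQ : P * Q = Matrix.scalar (Fin m) (I.pChar : 𝓞 F) * E') (h𝔭 : Ideal.span (Set.range fun k => P k 0) = w.asIdeal)
    -- § J's output: a line with the image-line membership law and the clause `ρ`
    (hJ : ∃ Lb : LineOf I y'',
      (∀ P'' : (fibreΩOf S Kc 𝓜 w e I.univ y'').Points (AlgebraicClosure (w.adicCompletion F)),
        P'' ∈ Lb.1 ↔
          IsIdealTorsionΩ S Kc 𝓜 w e I.univ I.act y'' ((IsCMField.complexConj F) • w).asIdeal P'' ∧
            ∃ P : (fibreΩOf S Kc 𝓜 w e I.univ y).Points (AlgebraicClosure (w.adicCompletion F)),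
              IsIdealTorsionΩ S Kc 𝓜 w e I.univ I.act y ((IsCMField.complexConj F) • w).asIdeal P ∧
                (AlgPoints.map c P'' : B.toAffine.toAbelianVariety.Points (AlgebraicClosure (w.adicCompletion F))) = AlgPoints.map q P) ∧
      ρ Lb)
    (h2 : ∀ P : (fibreΩOf S Kc 𝓜 w e I.univ y'').Points (AlgebraicClosure (w.adicCompletion F)),
      (AlgPoints.map c P : B.toAffine.toAbelianVariety.Points (AlgebraicClosure (w.adicCompletion F))) = 1 ↔
        IsIdealTorsionΩ S Kc 𝓜 w e I.univ I.act y'' w.asIdeal P)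
    (h2s : Function.Surjective c.left.base)
    (h4 : ∀ a : 𝓞 F, ∃ b : B.X ⟶ B.X,
      (actΩOf S Kc 𝓜 w e I.univ I.act a y).hom.hom.hom ≫ q = q ≫ b ∧ (actΩOf S Kc 𝓜 w e I.univ I.act a y'').hom.hom.hom ≫ c = c ≫ b)
    (hIMG : haveI := I.comm; haveI : IsProper (𝓜.localise w).total.hom := h𝓨.2
      (∀ (𝒦 : Over (Spec (.of (closureValuationSubring (w.adicCompletion F))))) (incl : 𝒦 ⟶ (I.univ.baseChange (extendPoint (closureValuationSubring (w.adicCompletion F)) (toClosureValuationSubring w) (𝓜.localise w).total ((𝓜.localise w).modelPointsEquiv.symm (thickeningLift e (S.M.obj Kc) y))).left).X) [Flat 𝒦.hom]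
        (𝒵 : Over (Spec (.of (closureValuationSubring (w.adicCompletion F))))) (ζ : 𝒵 ⟶ (I.univ.baseChange (extendPoint (closureValuationSubring (w.adicCompletion F)) (toClosureValuationSubring w) (𝓜.localise w).total ((𝓜.localise w).modelPointsEquiv.symm (thickeningLift e (S.M.obj Kc) y''))).left).X) [IsClosedImmersion (ζ ≫ baseChangeHom (serreTranslate I.act E' hE' P) (extendPoint (closureValuationSubring (w.adicCompletion F)) (toClosureValuationSubring w) (𝓜.localise w).total ((𝓜.localise w).modelPointsEquiv.symm (thickeningLift e (S.M.obj Kc) y''))).left).left],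
        (∃ m : (Over.pullback (specFractionFieldι (closureValuationSubring (w.adicCompletion F)) (toClosureValuationSubring w)).left).obj 𝒦 ⟶ (Over.pullback (specFractionFieldι (closureValuationSubring (w.adicCompletion F)) (toClosureValuationSubring w)).left).obj 𝒵,
          m ≫ (((Over.pullback (specFractionFieldι (closureValuationSubring (w.adicCompletion F)) (toClosureValuationSubring w)).left).map ζ ≫ (I.univ.fibreBaseChangeIso ((𝓜.localise w).genericIso'.inv.left ≫ pullback.fst (𝓜.localise w).total.hom (specGenericPoint (HeightOneSpectrum.valuationSubringAtPrime F w) F)) (thickeningLift e (S.M.obj Kc) y'').left ≪≫ I.univ.fibreCongrPtIso ((𝓜.localise w).left_specFractionFieldι_comp_extendPoint_modelPointsEquiv_symm (thickeningLift e (S.M.obj Kc) y'')).symm ≪≫ (I.univ.fibreBaseChangeIso (extendPoint (closureValuationSubring (w.adicCompletion F)) (toClosureValuationSubring w) (𝓜.localise w).total ((𝓜.localise w).modelPointsEquiv.symm (thickeningLift e (S.M.obj Kc) y''))).left (specFractionFieldι (closureValuationSubring (w.adicCompletion F)) (toClosureValuationSubring w)).left).symm).inv.hom.hom.hom) ≫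 c) =
            ((Over.pullback (specFractionFieldι (closureValuationSubring (w.adicCompletion F)) (toClosureValuationSubring w)).left).map incl ≫ (I.univ.fibreBaseChangeIso ((𝓜.localise w).genericIso'.inv.left ≫ pullback.fst (𝓜.localise w).total.hom (specGenericPoint (HeightOneSpectrum.valuationSubringAtPrime F w) F)) (thickeningLift e (S.M.obj Kc) y).left ≪≫ I.univ.fibreCongrPtIso ((𝓜.localise w).left_specFractionFieldι_comp_extendPoint_modelPointsEquiv_symm (thickeningLift e (S.M.obj Kc) y)).symm ≪≫ (I.univ.fibreBaseChangeIso (extendPoint (closureValuationSubring (w.adicCompletion F)) (toClosureValuationSubring w) (𝓜.localise w).total ((𝓜.localise w).modelPointsEquiv.symm (thickeningLift e (S.M.obj Kc) y))).left (specFractionFieldι (closureValuationSubring (w.adicCompletion F)) (toClosureValuationSubring w)).left).symm).inv.hom.hom.hom) ≫ q) →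
        ∃ m : (Over.pullback ((geomClosedPointIsoSpecResidueField w).inv.left ≫ (specRingHomι (closureValuationSubring (w.adicCompletion F)) (toClosureValuationSubring w) (IsLocalRing.residue (closureValuationSubring (w.adicCompletion F)))).left)).obj 𝒦 ⟶ (Over.pullback ((geomClosedPointIsoSpecResidueField w).inv.left ≫ (specRingHomι (closureValuationSubring (w.adicCompletion F)) (toClosureValuationSubring w) (IsLocalRing.residue (closureValuationSubring (w.adicCompletion F)))).left)).obj 𝒵,
          m ≫ (((Over.pullback ((geomClosedPointIsoSpecResidueField w).inv.left ≫ (specRingHomι (closureValuationSubring (w.adicCompletion F)) (toClosureValuationSubring w) (IsLocalRing.residue (closureValuationSubring (w.adicCompletion F)))).left)).map ζ ≫ (I.univ.fibreBaseChangeIso (pullback.fst (𝓜.localise w).total.hom (specResidueField w)) ((𝓜.localise w).geomReductionMap (thickeningLift e (S.M.obj Kc) y'')).left ≪≫ I.univ.fibreCongrPtIso (((𝓜.localise w).left_geomReductionMap_comp_fst (thickeningLift e (S.M.obj Kc) y'')).trans (Category.assoc _ _ _).symm) ≪≫ (I.univ.fibreBaseChangeIso (extendPoint (closureValuationSubring (w.adicCompletion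 F)) (toClosureValuationSubring w) (𝓜.localise w).total ((𝓜.localise w).modelPointsEquiv.symm (thickeningLift e (S.M.obj Kc) y''))).left ((geomClosedPointIsoSpecResidueField w).inv.left ≫ (specRingHomι (closureValuationSubring (w.adicCompletion F)) (toClosureValuationSubring w) (IsLocalRing.residue (closureValuationSubring (w.adicCompletion F)))).left)).symm).inv.hom.hom.hom) ≫ cbar) =
            ((Over.pullback ((geomClosedPointIsoSpecResidueField w).inv.left ≫ (specRingHomι (closureValuationSubring (w.adicCompletion F)) (toClosureValuationSubring w) (IsLocalRing.residue (closureValuationSubring (w.adicCompletion F)))).left)).map incl ≫ (I.univ.fibreBaseChangeIso (pullback.fst (𝓜.localise w).total.hom (specResidueField w)) ((𝓜.localise w).geomReductionMap (thickeningLift e (S.M.obj Kc) y)).left ≪≫ I.univ.fibreCongrPtIso (((𝓜.localise w).left_geomReductionMap_comp_fst (thickeningLift e (S.M.obj Kc) y)).trans (Category.assoc _ _ _).symm) ≪≫ (I.univ.fibreBaseChangeIso (extendPoint (closureValuationSubring (w.adicCompletion F)) (toClosureValuationSubring w) (𝓜.localise w).total ((𝓜.localise w).modelPointsEquiv.symm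 (thickeningLift e (S.M.obj Kc) y))).left ((geomClosedPointIsoSpecResidueField w).inv.left ≫ (specRingHomι (closureValuationSubring (w.adicCompletion F)) (toClosureValuationSubring w) (IsLocalRing.residue (closureValuationSubring (w.adicCompletion F)))).left)).symm).inv.hom.hom.hom) ≫ ψ)) :
    ∃ Lb : LineOf I y'', ρ Lb ∧
      (letI := (𝔡 (red₀Of S Kc 𝓜 w h𝓨 e y'')).grp₀; haveI := (𝔡 (red₀Of S Kc 𝓜 w h𝓨 e y'')).aff₀;
        ∀ ⦃T : SchemeOver (geomResidueField w)⦄ (t : T ⟶ (𝔡 (red₀Of S Kc 𝓜 w h𝓨 e y)).G₀),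
          ∃ s : T ⟶ specOver (geomResidueField w) (Alg (𝔡 (red₀Of S Kc 𝓜 w h𝓨 e y'')).G₀ ⧸ (spGeoOf I 𝔡 y'' Lb).1),
            s ≫ quotIncl (𝔡 (red₀Of S Kc 𝓜 w h𝓨 e y'')).G₀ (spGeoOf I 𝔡 y'' Lb).1 ≫ (𝔡 (red₀Of S Kc 𝓜 w h𝓨 e y'')).ι₀G ≫ cbar =
              t ≫ (𝔡 (red₀Of S Kc 𝓜 w h𝓨 e y)).ι₀G ≫ ψ) :=
  hJ.elim fun Lb hLb => ⟨Lb, hLb.2, fun _ t =>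
    himg_spGeoOf_of_roofRows I 𝔡 y y'' Lb q c ψ cbar E' hE' P Q hP hQ hQP hPQ h𝔭 hLb.1 h2 h2s h4 hIMG t⟩

end ImgRowAssembled

end Summit.HodgeConjecture.HodgeConjecture.Cruxes.HLiu418.F0P6aLineSpecialisation

end
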